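/- Free-seat work of EXTRA WIDTH SEAT `ym-line-cbag-p1-w4` (prover-ym-line-cbag-p1-w4-g2-0), route `EguchiKawaiDirectionLadder`
(ideator ym-idea-2, LINE 8), crux `TripleSmallBallMargin` (stmt-QuantumFields-27724), toward stub (b) `OffBlockDecoupling`
(ingredient 5b «polar/defect algebra» of the honest reduction (b♯) in the sizing note `sizing-27724-stubB.md`).
ROUTE-INDEPENDENT (no Theses import).  Nothing here bears on the Yang–Mills mass gap. -/
import Summits.QuantumFields.YangMills.Theorems.EguchiKawaiDirectionLadderBlockCompression
import Literature.Algebra.Lie.SelfAdjointHullPolar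
import Mathlib.Analysis.Matrix.Order
import HarnessLib

/-!
# Route `EguchiKawaiDirectionLadder`: the polar unitary of an invertible matrix and its defect

For an invertible `M ∈ M_n(ℂ)` (a compression `(U_μ)_{II}` of a Haar link, generically) the POLAR UNITARY
`Θ = (MM†)^{-1/2} M` satisfies the DEFECT IDENTITY

  `M − Θ = −(1 − MM†) · X`,   `‖X‖_op ≤ 1`   (`X = ((MM†)^{1/2} + 1)⁻¹ Θ`)            (`exists_polar_defect`)

so that any splitting of the unitary defect `1 − MM† = D_near + D_far` into a LOW-RANK part and a FROBENIUS-SMALL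
part passes to `M − Θ`: `M = Θ − D_near X − D_far X` with `rank(D_near X) ≤ rank D_near` and
`Σ|(D_far X)_{ij}|² ≤ Σ|(D_far)_{ij}|²` (`exists_unitary_sub_eq_of_defect_split`) — the form «unitary + rank-κn + small»
of a compression used by the rank-robust within-cluster level (a♯) proposed for crux `TripleSmallBallMargin`.

Ingredients: the tree's polar decomposition material `Literature.Algebra.Lie.SelfAdjointHullPolar`
(`exists_isHermitian_exp_eq_of_posDef`: `MM† = exp A`, `A` Hermitian; `H = exp(A/2)`, `Θ = exp(−A/2) M`), the operator
inequality `‖(H + 1)⁻¹‖ ≤ 1` for `H ≥ 0` through Mathlib's C⋆-order on matrices (`CStarAlgebra.inv_le_one`), and the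
Frobenius–operator submultiplicativity `Σ|(Y X)_{ij}|² ≤ ‖X‖² Σ|Y_{ij}|²` for a general finite index type (the tree's
`frobSq_mul_le'` is stated for `Fin N`).

HONEST FRAMING: linear algebra only (no measure, no small-ball estimate); the singular case (`det M = 0`) is not
treated here (in the intended use it is absorbed into the rank slack or removed by a generic perturbation).  The route
bears on the barrier-ledger fact `EguchiKawaiBreakdown` only.
-/

set_option autoImplicit false

noncomputable section

open NormedSpace
open scoped Matrix ComplexOrder MatrixOrder Matrix.Norms.L2Operator

namespace Summit.QuantumFields.YangMills.Theorems.EguchiKawaiDirectionLadder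

variable {n : Type} [Fintype n] [DecidableEq n]

/-! ### §1 Frobenius sums versus the operator norm, general finite index type -/

section Frobenius

omit [DecidableEq n] in
/-- Column form of the Frobenius sum: `Σ_{ij}|M_{ij}|² = Σ_j ‖M e_j‖₂²`. -/
theorem sum_norm_sq_eq_sum_col (M : Matrix n n ℂ) :
    ∑ i, ∑ j, ‖M i j‖ ^ 2 = ∑ j, ‖(EuclideanSpace.equiv n ℂ).symm (M.col j)‖ ^ 2 := by
  rw [Finset.sum_comm]
  refine Finset.sum_congr rfl fun j _ => ?_
  rw [EuclideanSpace.norm_sq_eq]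
  rfl

omit [DecidableEq n] in
/-- Columns of a product: `(XY) e_j = X (Y e_j)`. -/
theorem col_mul_eq_mulVec' (X Y : Matrix n n ℂ) (j : n) : (X * Y).col j = Matrix.mulVec X (Y.col j) := by
  ext i
  simp [Matrix.mul_apply, Matrix.mulVec, dotProduct]

/-- `Σ|(XY)_{ij}|² ≤ ‖X‖_op² · Σ|Y_{ij}|²`. -/
theorem sum_norm_sq_mul_le (X Y : Matrix n n ℂ) :
    ∑ i, ∑ j, ‖(X * Y) i j‖ ^ 2 ≤ ‖X‖ ^ 2 * ∑ i, ∑ j, ‖Y i j‖ ^ 2 := by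
  rw [sum_norm_sq_eq_sum_col, sum_norm_sq_eq_sum_col, Finset.mul_sum]
  refine Finset.sum_le_sum fun j _ => ?_
  rw [col_mul_eq_mulVec']
  set w : EuclideanSpace ℂ n := (EuclideanSpace.equiv n ℂ).symm (Y.col j) with hw
  have hwo : w.ofLp = Y.col j := rfl
  have h := Matrix.l2_opNorm_mulVec X w
  rw [hwo] at h
  have h0 : 0 ≤ ‖(EuclideanSpace.equiv n ℂ).symm (Matrix.mulVec X (Y.col j))‖ := norm_nonneg _
  calc ‖(EuclideanSpace.equiv n ℂ).symm (Matrix.mulVec X (Y.col j))‖ ^ 2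
      ≤ (‖X‖ * ‖(EuclideanSpace.equiv n ℂ).symm (Y.col j)‖) ^ 2 := pow_le_pow_left₀ h0 h 2
    _ = ‖X‖ ^ 2 * ‖(EuclideanSpace.equiv n ℂ).symm (Y.col j)‖ ^ 2 := by ring

omit [DecidableEq n] in
/-- `Σ|(Mᴴ)_{ij}|² = Σ|M_{ij}|²`. -/
theorem sum_norm_sq_conjTranspose (M : Matrix n n ℂ) :
    ∑ i, ∑ j, ‖Mᴴ i j‖ ^ 2 = ∑ i, ∑ j, ‖M i j‖ ^ 2 := by
  rw [Finset.sum_comm]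
  simp [Matrix.conjTranspose_apply]

/-- `Σ|(YX)_{ij}|² ≤ ‖X‖_op² · Σ|Y_{ij}|²` (right multiplication by the operator; via adjoints). -/
theorem sum_norm_sq_mul_le' (X Y : Matrix n n ℂ) :
    ∑ i, ∑ j, ‖(Y * X) i j‖ ^ 2 ≤ ‖X‖ ^ 2 * ∑ i, ∑ j, ‖Y i j‖ ^ 2 := by
  rw [← sum_norm_sq_conjTranspose, Matrix.conjTranspose_mul]
  calc ∑ i, ∑ j, ‖(Xᴴ * Yᴴ) i j‖ ^ 2 ≤ ‖Xᴴ‖ ^ 2 * ∑ i, ∑ j, ‖Yᴴ i j‖ ^ 2 := sum_norm_sq_mul_le _ _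
    _ = ‖X‖ ^ 2 * ∑ i, ∑ j, ‖Y i j‖ ^ 2 := by rw [Matrix.l2_opNorm_conjTranspose, sum_norm_sq_conjTranspose]

end Frobenius

/-! ### §2 The polar unitary and the defect identity -/

section Polar

/-- `‖(H + 1)⁻¹‖_op ≤ 1` for a positive semidefinite `H` (C⋆-order: `1 ≤ H + 1`, inversion is antitone). -/
theorem norm_inv_add_one_le_one {H : Matrix n n ℂ} (hH : H.PosSemidef) : ‖(H + 1)⁻¹‖ ≤ 1 := by
  letI : CStarAlgebra (Matrix n n ℂ) := {}
  have hH0 : (0 : Matrix n n ℂ) ≤ H := hH.nonneg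
  have h1 : (1 : Matrix n n ℂ) ≤ H + 1 := le_add_of_nonneg_left hH0
  have hunit : IsUnit (H + 1) := (Matrix.PosDef.posSemidef_add hH Matrix.PosDef.one).isUnit
  set u : (Matrix n n ℂ)ˣ := hunit.unit with hu
  have hu' : (u : Matrix n n ℂ) = H + 1 := hunit.unit_spec
  have h1u : (1 : Matrix n n ℂ) ≤ (u : Matrix n n ℂ) := by rw [hu']; exact h1
  have h0u : (0 : Matrix n n ℂ) ≤ (u : Matrix n n ℂ) := zero_le_one.trans h1u
  have hinv_le : ((u⁻¹ : (Matrix n n ℂ)ˣ) : Matrix n n ℂ) ≤ 1 := CStarAlgebra.inv_le_one h1u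
  have hinv_nonneg : (0 : Matrix n n ℂ) ≤ ((u⁻¹ : (Matrix n n ℂ)ˣ) : Matrix n n ℂ) :=
    CFC.inv_nonneg_of_nonneg u h0u
  have hnorm : ‖((u⁻¹ : (Matrix n n ℂ)ˣ) : Matrix n n ℂ)‖ ≤ 1 :=
    (CStarAlgebra.norm_le_one_iff_of_nonneg _ hinv_nonneg).mpr hinv_le
  rwa [Matrix.coe_units_inv, hu'] at hnorm

/-- **The polar unitary and the defect identity.** For an invertible `M ∈ M_n(ℂ)` there are a unitary `Θ` and a
matrix `X` with `‖X‖_op ≤ 1` such that `M − Θ = −(1 − M M†) · X`.  (`Θ = (MM†)^{-1/2} M`,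
`X = ((MM†)^{1/2} + 1)⁻¹ Θ`.) -/
theorem exists_polar_defect (M : Matrix n n ℂ) (hM : IsUnit M) :
    ∃ Θ : Matrix n n ℂ, Θ ∈ Matrix.unitaryGroup n ℂ ∧ ∃ X : Matrix n n ℂ, ‖X‖ ≤ 1 ∧
      M - Θ = -((1 - M * Mᴴ) * X) := by
  letI : CStarAlgebra (Matrix n n ℂ) := {}
  obtain ⟨g, rfl⟩ := hM
  -- `Q = MM† = exp A`, `A` Hermitian
  have hQ : ((g : Matrix n n ℂ) * star (g : Matrix n n ℂ)).PosDef :=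
    Literature.Algebra.Lie.SelfAdjointHullPolar.posDef_mul_star g
  obtain ⟨A, hA, hAQ⟩ := Literature.Algebra.Lie.SelfAdjointHullPolar.exists_isHermitian_exp_eq_of_posDef hQ
  -- `Y = A/2`, `H = exp Y`
  set Y : Matrix n n ℂ := (2⁻¹ : ℂ) • A with hYdef
  have hY : Y.IsHermitian := by
    unfold Matrix.IsHermitian
    rw [hYdef, Matrix.conjTranspose_smul, hA.eq]
    congr 1
    rw [Complex.star_def, map_inv₀, map_ofNat]
  have hYY : Y + Y = A := by rw [hYdef, ← two_smul ℂ, smul_smul, mul_inv_cancel₀ two_ne_zero, one_smul]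
  have hstarY : star Y = Y := by rw [Matrix.star_eq_conjTranspose, hY.eq]
  set H : Matrix n n ℂ := exp Y with hHdef
  have hHH : H * H = (g : Matrix n n ℂ) * star (g : Matrix n n ℂ) := by
    rw [← hAQ, ← hYY, Matrix.exp_add_of_commute _ _ (Commute.refl Y)]
  have hinv : exp (-Y) * H = 1 := by
    rw [hHdef, ← Matrix.exp_add_of_commute _ _ (Commute.refl Y).neg_left, neg_add_cancel, exp_zero]
  have hinv' : H * exp (-Y) = 1 := by
    rw [hHdef, ← Matrix.exp_add_of_commute _ _ (Commute.refl Y).neg_right, add_neg_cancel, exp_zero]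
  -- `H` is positive semidefinite: `H = exp(Y/2) exp(Y/2)†`
  set Z : Matrix n n ℂ := (2⁻¹ : ℂ) • Y with hZdef
  have hZ : Z.IsHermitian := by
    unfold Matrix.IsHermitian
    rw [hZdef, Matrix.conjTranspose_smul, hY.eq]
    congr 1
    rw [Complex.star_def, map_inv₀, map_ofNat]
  have hZZ : Z + Z = Y := by rw [hZdef, ← two_smul ℂ, smul_smul, mul_inv_cancel₀ two_ne_zero, one_smul]
  have hHZ : H = exp Z * (exp Z)ᴴ := by
    have hstarZ : (exp Z)ᴴ = exp Z := by
      rw [← Matrix.star_eq_conjTranspose, star_exp, Matrix.star_eq_conjTranspose, hZ.eq]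
    rw [hstarZ, hHdef, ← hZZ, Matrix.exp_add_of_commute _ _ (Commute.refl Z)]
  have hHpsd : H.PosSemidef := by rw [hHZ]; exact Matrix.posSemidef_self_mul_conjTranspose _
  -- the polar unitary
  set Θ : Matrix n n ℂ := exp (-Y) * (g : Matrix n n ℂ) with hΘdef
  have hΘ1 : Θ * star Θ = 1 := by
    calc Θ * star Θ = exp (-Y) * ((g : Matrix n n ℂ) * star (g : Matrix n n ℂ)) * exp (-Y) := by
          rw [hΘdef, star_mul, star_exp, star_neg, hstarY]; simp only [mul_assoc]
      _ = (exp (-Y) * H) * (H * exp (-Y)) := by rw [← hHH]; simp only [mul_assoc]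
      _ = 1 := by rw [hinv, hinv', mul_one]
  have hΘ : Θ ∈ Matrix.unitaryGroup n ℂ := Matrix.mem_unitaryGroup_iff.2 hΘ1
  -- `M = H Θ`, `M − Θ = (H − 1) Θ`
  have hMΘ : (g : Matrix n n ℂ) = H * Θ := by rw [hΘdef, ← mul_assoc, hinv', one_mul]
  -- `(H − 1)(H + 1) = H² − 1` and `H + 1` invertible
  have hunit : IsUnit (H + 1) := (Matrix.PosDef.posSemidef_add hHpsd Matrix.PosDef.one).isUnit
  have hdet : IsUnit (H + 1).det := (Matrix.isUnit_iff_isUnit_det _).mp hunit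
  have hfac : H - 1 = (H * H - 1) * (H + 1)⁻¹ := by
    have h2 : (H - 1) * (H + 1) = H * H - 1 := by noncomm_ring
    rw [← h2, mul_assoc, Matrix.mul_nonsing_inv _ hdet, mul_one]
  refine ⟨Θ, hΘ, (H + 1)⁻¹ * Θ, ?_, ?_⟩
  · -- `‖(H+1)⁻¹ Θ‖ = ‖(H+1)⁻¹‖ ≤ 1`
    have : ‖(H + 1)⁻¹ * Θ‖ = ‖(H + 1)⁻¹‖ := CStarRing.norm_mul_coe_unitary (H + 1)⁻¹ ⟨Θ, hΘ⟩
    rw [this]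
    exact norm_inv_add_one_le_one hHpsd
  · -- the defect identity
    calc (g : Matrix n n ℂ) - Θ = (H - 1) * Θ := by rw [hMΘ]; noncomm_ring
      _ = (H * H - 1) * (H + 1)⁻¹ * Θ := by rw [hfac]
      _ = -((1 - (g : Matrix n n ℂ) * (g : Matrix n n ℂ)ᴴ) * ((H + 1)⁻¹ * Θ)) := by
          rw [hHH, Matrix.star_eq_conjTranspose]; noncomm_ring

/-- **Unitary + low rank + small.** If `M` is invertible and its unitary defect splits as `1 − MM† = D₁ + D₂`, then
`M = Θ + R + S` with `Θ` unitary, `R = −D₁X` of rank `≤ rank D₁` and `S = −D₂X` with `Σ|S_{ij}|² ≤ Σ|(D₂)_{ij}|²`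
(`‖X‖_op ≤ 1`).  In the use: `D₁` = near part (rank `≤ κn`), `D₂` = far part (Frobenius-small). -/
theorem exists_unitary_add_lowRank_add_small (M D₁ D₂ : Matrix n n ℂ) (hM : IsUnit M)
    (hD : 1 - M * Mᴴ = D₁ + D₂) :
    ∃ Θ R S : Matrix n n ℂ, Θ ∈ Matrix.unitaryGroup n ℂ ∧ R.rank ≤ D₁.rank ∧
      ∑ i, ∑ j, ‖S i j‖ ^ 2 ≤ ∑ i, ∑ j, ‖D₂ i j‖ ^ 2 ∧ M = Θ + R + S := by
  obtain ⟨Θ, hΘ, X, hX, hMX⟩ := exists_polar_defect M hM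
  refine ⟨Θ, -(D₁ * X), -(D₂ * X), hΘ, ?_, ?_, ?_⟩
  · rw [rank_neg]; exact Matrix.rank_mul_le_left _ _
  · have h := sum_norm_sq_mul_le' X D₂
    have hX1 : ‖X‖ ^ 2 ≤ 1 := by
      have := norm_nonneg X
      nlinarith
    have h0 : 0 ≤ ∑ i, ∑ j, ‖D₂ i j‖ ^ 2 := Finset.sum_nonneg fun _ _ => Finset.sum_nonneg fun _ _ => by positivity
    calc ∑ i, ∑ j, ‖(-(D₂ * X)) i j‖ ^ 2 = ∑ i, ∑ j, ‖(D₂ * X) i j‖ ^ 2 := by simp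
      _ ≤ ‖X‖ ^ 2 * ∑ i, ∑ j, ‖D₂ i j‖ ^ 2 := h
      _ ≤ 1 * ∑ i, ∑ j, ‖D₂ i j‖ ^ 2 := by gcongr
      _ = ∑ i, ∑ j, ‖D₂ i j‖ ^ 2 := one_mul _
  · calc M = Θ + (M - Θ) := by abel
      _ = Θ + -(D₁ * X) + -(D₂ * X) := by rw [hMX, hD]; noncomm_ring

end Polar

end Summit.QuantumFields.YangMills.Theorems.EguchiKawaiDirectionLadder

end
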